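import Summits.AtomisticToContinuum.Crystallization.Theorems.HullExactificationCascadeRobustBarlowTemplateInjectiveCellCore

/-!
# Cell packages, part A (line `registered`, crux `RobustBarlowTemplate`, stmt-AtomisticToContinuum-12088)

Toward the registered stub `develop_injective` (the STAR ESTIMATE `injective_starApprox`): the
CELL PACKAGE `injective_good_of` of `…InjectiveCellCore.lean` instantiated for the first four of the six
closed cells of a prism `(k, i, j)` of the refined Barlow honeycomb (cell formulas of
`…HoneycombContinuousA.lean`, closedness from `…HoneycombContinuous.lean`).  For each cell: the
membership predicate and the weights of `plData`, the four vertex index triples, and the VERTEX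
ERROR MATRIX `M` (`1/20` for a contact pair, `61/190` for the diagonal pair `C–D` of a quarter
octahedron — `injective_far_CD/DC` — and `0` on the diagonal; row sums `3/20` or `8/19 ≤ 9/20`).

## Contents
* `injective_good_up` — the cell `T↑ = {(0,0,0), (1,0,0), (0,1,0), (0,0,1)}`;
* `injective_good_down` — the cell `T↓ = {(1,1,0), (1,0,1), (0,1,1), (1,1,1)}`;
* `injective_good_AB` — the cell quarter `{C, D, A, B}` (`C = (1,1,0)`, `D = (0,0,1)`, `A = (1,0,0)`, `B = (0,1,0)`);
* `injective_good_EA` — the cell quarter `{C, D, E, A}` (`E = (1,0,1)`);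
* `injective_goodUp` — registered anchor (the package of `T↑`, star-estimate clause).
-/

noncomputable section

namespace Summit.AtomisticToContinuum.Crystallization.Theorems.HullExactificationCascadeRobustBarlowTemplate

open Literature.MathematicalPhysics.StatisticalMechanics

/-- Euclidean `3`-space. -/
local notation "E3" => EuclideanSpace ℝ (Fin 3)

/-- CELL PACKAGE for the closed cell `T↑ = {(0,0,0), (1,0,0), (0,1,0), (0,0,1)}` of prism `(k, i, j)`: closed, convex,
hat functions `√2`-Lipschitz, star estimate `27/40 · l` from every vertex. -/
theorem injective_good_up {s : ℤ → ℤ} (hs : IsHaggSeq s) (k i j : ℤ) :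
    ∀ C : Set E3, C = {x : E3 | 0 ≤ toSkew s k x 0 - i ∧ 0 ≤ toSkew s k x 1 - j ∧ 0 ≤ toSkew s k x 2 ∧
        (toSkew s k x 0 - i) + (toSkew s k x 1 - j) + toSkew s k x 2 ≤ 1} →
      IsClosed C ∧ Convex ℝ C ∧
      (∀ t₀ : ℤ × ℤ × ℤ, ∀ z ∈ C, ∀ z' ∈ C,
        |plExtend s (fun t => if t = t₀ then (1 : ℝ) else 0) z -
          plExtend s (fun t => if t = t₀ then (1 : ℝ) else 0) z'| ≤ Real.sqrt 2 * ‖z - z'‖) ∧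
      (∀ Ψ : E3 → E3, LocSim s Ψ → ∀ (t₀ : ℤ × ℤ × ℤ) (A : E3 →ₗᵢ[ℝ] E3) (l : ℝ), 0 < l →
        (∀ q ∈ idealStacking s, dist q (siteAt s t₀) ≤ 1 →
          dist (Ψ q) (Ψ (siteAt s t₀) + l • A (q - siteAt s t₀)) ≤ 1 / 20 * l) →
        (∃ y ∈ C, plExtend s (fun t => if t = t₀ then (1 : ℝ) else 0) y ≠ 0) →
        ∀ z ∈ C, ∀ z' ∈ C, ‖plExtend s (fun t => Ψ (siteAt s t)) z -
          plExtend s (fun t => Ψ (siteAt s t)) z' - l • A (z - z')‖ ≤ 27 / 40 * l * ‖z - z'‖) := by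
  rintro C rfl
  refine injective_good_of hs k i j (fun a b θ => 0 ≤ a ∧ 0 ≤ b ∧ 0 ≤ θ ∧ a + b + θ ≤ 1)
    ![fun a b θ => 1 - a - b - θ, fun a _ _ => a, fun _ b _ => b, fun _ _ θ => θ]
    ![skewSite s k i j 0, skewSite s k (i + 1) j 0, skewSite s k i (j + 1) 0, skewSite s k i j 1]
    _ rfl (honeycomb_cellUp_continuousOn hs (fun _ => (0 : ℝ)) k i j).1 ?_ ?_ ?_ ?_ ?_ ?_
    ![![0, 1 / 20, 1 / 20, 1 / 20], ![1 / 20, 0, 1 / 20, 1 / 20], ![1 / 20, 1 / 20, 0, 1 / 20],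
      ![1 / 20, 1 / 20, 1 / 20, 0]] ?_ ?_
  · rintro a b θ a' b' θ' p q hp hq hpq ⟨h1, h2, h3, h4⟩ ⟨h1', h2', h3', h4'⟩
    refine ⟨?_, ?_, ?_, ?_⟩ <;> nlinarith [mul_nonneg hp (sub_nonneg.2 h1), mul_nonneg hq (sub_nonneg.2 h1'),
      mul_nonneg hp (sub_nonneg.2 h2), mul_nonneg hq (sub_nonneg.2 h2'), mul_nonneg hp (sub_nonneg.2 h3),
      mul_nonneg hq (sub_nonneg.2 h3'), mul_nonneg hp (sub_nonneg.2 h4), mul_nonneg hq (sub_nonneg.2 h4')]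
  · rintro W _ _ g a b θ ⟨h1, h2, h3, h4⟩
    rw [honeycomb_plExtend_cellUp hs g k i j a b θ h1 h2 h3 h4, Fin.sum_univ_four]
    simp
  · intro a b θ
    rw [Fin.sum_univ_four]
    simp only [Matrix.cons_val_zero, Matrix.cons_val_one, Matrix.cons_val]
    rw [honeycomb_siteAt_skewSite s k i j 0 (Or.inl rfl) hs,
      honeycomb_siteAt_skewSite s k (i + 1) j 0 (Or.inl rfl) hs,
      honeycomb_siteAt_skewSite s k i (j + 1) 0 (Or.inl rfl) hs,
      honeycomb_siteAt_skewSite s k i j 1 (Or.inr rfl) hs]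
    simp only [ofSkew, Matrix.cons_val_zero, Matrix.cons_val_one, Matrix.cons_val]
    push_cast
    module
  · intro a b θ
    simp only [Fin.sum_univ_four, Matrix.cons_val_zero, Matrix.cons_val_one, Matrix.cons_val]
    ring
  · intro m a b θ a' b' θ'
    obtain ⟨f1, f2, f3, f4, f5, f6, f7⟩ := injective_forms (a - a') (b - b') (θ - θ')
    rw [honeycomb_sqdist_ofSkew s k (hs k)]
    fin_cases m <;> simp <;> nlinarith [f1, f2, f3, f4, f5, f6, f7]
  · intro m m' h
    fin_cases m <;> fin_cases m' <;> simp [injective_skewSite_eq_iff (hs k)] at h ⊢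
  · intro m₀
    fin_cases m₀ <;> simp [Fin.sum_univ_four] <;> norm_num
  · intro Ψ hL m₀ A l hl hcl m
    fin_cases m₀ <;> fin_cases m <;>
      simp only [Matrix.cons_val_zero, Matrix.cons_val_one, Matrix.cons_val, Fin.isValue, Fin.mk_one,
        Fin.zero_eta, Fin.reduceFinMk] at hcl ⊢ <;>
      first
        | (simp; done)
        | (rw [← dist_eq_norm]
           exact hcl _ (injective_site_mem s _)
             (injective_site_dist_le_one hs k _ _ _ _ _ _ (by norm_num) (by norm_num) (by push_cast; ring)))

/-- CELL PACKAGE for the closed cell `T↓ = {(1,1,0), (1,0,1), (0,1,1), (1,1,1)}` of prism `(k, i, j)`: closed, convex,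
hat functions `√2`-Lipschitz, star estimate `27/40 · l` from every vertex. -/
theorem injective_good_down {s : ℤ → ℤ} (hs : IsHaggSeq s) (k i j : ℤ) :
    ∀ C : Set E3, C = {x : E3 | toSkew s k x 0 - i ≤ 1 ∧ toSkew s k x 1 - j ≤ 1 ∧ toSkew s k x 2 ≤ 1 ∧
        2 ≤ (toSkew s k x 0 - i) + (toSkew s k x 1 - j) + toSkew s k x 2} →
      IsClosed C ∧ Convex ℝ C ∧
      (∀ t₀ : ℤ × ℤ × ℤ, ∀ z ∈ C, ∀ z' ∈ C,
        |plExtend s (fun t => if t = t₀ then (1 : ℝ) else 0) z -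
          plExtend s (fun t => if t = t₀ then (1 : ℝ) else 0) z'| ≤ Real.sqrt 2 * ‖z - z'‖) ∧
      (∀ Ψ : E3 → E3, LocSim s Ψ → ∀ (t₀ : ℤ × ℤ × ℤ) (A : E3 →ₗᵢ[ℝ] E3) (l : ℝ), 0 < l →
        (∀ q ∈ idealStacking s, dist q (siteAt s t₀) ≤ 1 →
          dist (Ψ q) (Ψ (siteAt s t₀) + l • A (q - siteAt s t₀)) ≤ 1 / 20 * l) →
        (∃ y ∈ C, plExtend s (fun t => if t = t₀ then (1 : ℝ) else 0) y ≠ 0) →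
        ∀ z ∈ C, ∀ z' ∈ C, ‖plExtend s (fun t => Ψ (siteAt s t)) z -
          plExtend s (fun t => Ψ (siteAt s t)) z' - l • A (z - z')‖ ≤ 27 / 40 * l * ‖z - z'‖) := by
  rintro C rfl
  refine injective_good_of hs k i j (fun a b θ => a ≤ 1 ∧ b ≤ 1 ∧ θ ≤ 1 ∧ 2 ≤ a + b + θ)
    ![fun _ _ θ => 1 - θ, fun _ b _ => 1 - b, fun a _ _ => 1 - a, fun a b θ => a + b + θ - 2]
    ![skewSite s k (i + 1) (j + 1) 0, skewSite s k (i + 1) j 1, skewSite s k i (j + 1) 1, skewSite s k (i + 1) (j + 1) 1]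
    _ rfl (honeycomb_cellDown_continuousOn hs (fun _ => (0 : ℝ)) k i j).1 ?_ ?_ ?_ ?_ ?_ ?_
    ![![0, 1 / 20, 1 / 20, 1 / 20], ![1 / 20, 0, 1 / 20, 1 / 20], ![1 / 20, 1 / 20, 0, 1 / 20],
      ![1 / 20, 1 / 20, 1 / 20, 0]] ?_ ?_
  · rintro a b θ a' b' θ' p q hp hq hpq ⟨h1, h2, h3, h4⟩ ⟨h1', h2', h3', h4'⟩
    refine ⟨?_, ?_, ?_, ?_⟩ <;> nlinarith [mul_nonneg hp (sub_nonneg.2 h1), mul_nonneg hq (sub_nonneg.2 h1'),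
      mul_nonneg hp (sub_nonneg.2 h2), mul_nonneg hq (sub_nonneg.2 h2'), mul_nonneg hp (sub_nonneg.2 h3),
      mul_nonneg hq (sub_nonneg.2 h3'), mul_nonneg hp (sub_nonneg.2 h4), mul_nonneg hq (sub_nonneg.2 h4')]
  · rintro W _ _ g a b θ ⟨h1, h2, h3, h4⟩
    rw [honeycomb_plExtend_cellDown hs g k i j a b θ h1 h2 h3 h4, Fin.sum_univ_four]
    simp
  · intro a b θ
    rw [Fin.sum_univ_four]
    simp only [Matrix.cons_val_zero, Matrix.cons_val_one, Matrix.cons_val]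
    rw [honeycomb_siteAt_skewSite s k (i + 1) (j + 1) 0 (Or.inl rfl) hs,
      honeycomb_siteAt_skewSite s k (i + 1) j 1 (Or.inr rfl) hs,
      honeycomb_siteAt_skewSite s k i (j + 1) 1 (Or.inr rfl) hs,
      honeycomb_siteAt_skewSite s k (i + 1) (j + 1) 1 (Or.inr rfl) hs]
    simp only [ofSkew, Matrix.cons_val_zero, Matrix.cons_val_one, Matrix.cons_val]
    push_cast
    module
  · intro a b θ
    simp only [Fin.sum_univ_four, Matrix.cons_val_zero, Matrix.cons_val_one, Matrix.cons_val]
    ring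
  · intro m a b θ a' b' θ'
    obtain ⟨f1, f2, f3, f4, f5, f6, f7⟩ := injective_forms (a - a') (b - b') (θ - θ')
    rw [honeycomb_sqdist_ofSkew s k (hs k)]
    fin_cases m <;> simp <;> nlinarith [f1, f2, f3, f4, f5, f6, f7]
  · intro m m' h
    fin_cases m <;> fin_cases m' <;> simp [injective_skewSite_eq_iff (hs k)] at h ⊢
  · intro m₀
    fin_cases m₀ <;> simp [Fin.sum_univ_four] <;> norm_num
  · intro Ψ hL m₀ A l hl hcl m
    fin_cases m₀ <;> fin_cases m <;>
      simp only [Matrix.cons_val_zero, Matrix.cons_val_one, Matrix.cons_val, Fin.isValue, Fin.mk_one,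
        Fin.zero_eta, Fin.reduceFinMk] at hcl ⊢ <;>
      first
        | (simp; done)
        | (rw [← dist_eq_norm]
           exact hcl _ (injective_site_mem s _)
             (injective_site_dist_le_one hs k _ _ _ _ _ _ (by norm_num) (by norm_num) (by push_cast; ring)))

/-- CELL PACKAGE for the closed cell quarter `{C, D, A, B}` (`C = (1,1,0)`, `D = (0,0,1)`, `A = (1,0,0)`, `B = (0,1,0)`) of prism `(k, i, j)`: closed, convex,
hat functions `√2`-Lipschitz, star estimate `27/40 · l` from every vertex. -/
theorem injective_good_AB {s : ℤ → ℤ} (hs : IsHaggSeq s) (k i j : ℤ) :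
    ∀ C : Set E3, C = {x : E3 | 0 ≤ toSkew s k x 2 ∧ 1 ≤ (toSkew s k x 0 - i) + (toSkew s k x 1 - j) + toSkew s k x 2 ∧
        (toSkew s k x 1 - j) + toSkew s k x 2 ≤ 1 ∧ (toSkew s k x 0 - i) + toSkew s k x 2 ≤ 1} →
      IsClosed C ∧ Convex ℝ C ∧
      (∀ t₀ : ℤ × ℤ × ℤ, ∀ z ∈ C, ∀ z' ∈ C,
        |plExtend s (fun t => if t = t₀ then (1 : ℝ) else 0) z -
          plExtend s (fun t => if t = t₀ then (1 : ℝ) else 0) z'| ≤ Real.sqrt 2 * ‖z - z'‖) ∧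
      (∀ Ψ : E3 → E3, LocSim s Ψ → ∀ (t₀ : ℤ × ℤ × ℤ) (A : E3 →ₗᵢ[ℝ] E3) (l : ℝ), 0 < l →
        (∀ q ∈ idealStacking s, dist q (siteAt s t₀) ≤ 1 →
          dist (Ψ q) (Ψ (siteAt s t₀) + l • A (q - siteAt s t₀)) ≤ 1 / 20 * l) →
        (∃ y ∈ C, plExtend s (fun t => if t = t₀ then (1 : ℝ) else 0) y ≠ 0) →
        ∀ z ∈ C, ∀ z' ∈ C, ‖plExtend s (fun t => Ψ (siteAt s t)) z -
          plExtend s (fun t => Ψ (siteAt s t)) z' - l • A (z - z')‖ ≤ 27 / 40 * l * ‖z - z'‖) := by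
  rintro C rfl
  refine injective_good_of hs k i j (fun a b θ => 0 ≤ θ ∧ 1 ≤ a + b + θ ∧ b + θ ≤ 1 ∧ a + θ ≤ 1)
    ![fun a b θ => a + b + θ - 1, fun _ _ θ => θ, fun _ b θ => 1 - b - θ, fun a _ θ => 1 - a - θ]
    ![skewSite s k (i + 1) (j + 1) 0, skewSite s k i j 1, skewSite s k (i + 1) j 0, skewSite s k i (j + 1) 0]
    _ rfl (honeycomb_cellAB_continuousOn hs (fun _ => (0 : ℝ)) k i j).1 ?_ ?_ ?_ ?_ ?_ ?_
    ![![0, 61 / 190, 1 / 20, 1 / 20], ![61 / 190, 0, 1 / 20, 1 / 20], ![1 / 20, 1 / 20, 0, 1 / 20],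
      ![1 / 20, 1 / 20, 1 / 20, 0]] ?_ ?_
  · rintro a b θ a' b' θ' p q hp hq hpq ⟨h1, h2, h3, h4⟩ ⟨h1', h2', h3', h4'⟩
    refine ⟨?_, ?_, ?_, ?_⟩ <;> nlinarith [mul_nonneg hp (sub_nonneg.2 h1), mul_nonneg hq (sub_nonneg.2 h1'),
      mul_nonneg hp (sub_nonneg.2 h2), mul_nonneg hq (sub_nonneg.2 h2'), mul_nonneg hp (sub_nonneg.2 h3),
      mul_nonneg hq (sub_nonneg.2 h3'), mul_nonneg hp (sub_nonneg.2 h4), mul_nonneg hq (sub_nonneg.2 h4')]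
  · rintro W _ _ g a b θ ⟨h1, h2, h3, h4⟩
    rw [honeycomb_plExtend_cellAB hs g k i j a b θ h1 h2 h3 h4, Fin.sum_univ_four]
    simp
  · intro a b θ
    rw [Fin.sum_univ_four]
    simp only [Matrix.cons_val_zero, Matrix.cons_val_one, Matrix.cons_val]
    rw [honeycomb_siteAt_skewSite s k (i + 1) (j + 1) 0 (Or.inl rfl) hs,
      honeycomb_siteAt_skewSite s k i j 1 (Or.inr rfl) hs,
      honeycomb_siteAt_skewSite s k (i + 1) j 0 (Or.inl rfl) hs,
      honeycomb_siteAt_skewSite s k i (j + 1) 0 (Or.inl rfl) hs]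
    simp only [ofSkew, Matrix.cons_val_zero, Matrix.cons_val_one, Matrix.cons_val]
    push_cast
    module
  · intro a b θ
    simp only [Fin.sum_univ_four, Matrix.cons_val_zero, Matrix.cons_val_one, Matrix.cons_val]
    ring
  · intro m a b θ a' b' θ'
    obtain ⟨f1, f2, f3, f4, f5, f6, f7⟩ := injective_forms (a - a') (b - b') (θ - θ')
    rw [honeycomb_sqdist_ofSkew s k (hs k)]
    fin_cases m <;> simp <;> nlinarith [f1, f2, f3, f4, f5, f6, f7]
  · intro m m' h
    fin_cases m <;> fin_cases m' <;> simp [injective_skewSite_eq_iff (hs k)] at h ⊢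
  · intro m₀
    fin_cases m₀ <;> simp [Fin.sum_univ_four] <;> norm_num
  · intro Ψ hL m₀ A l hl hcl m
    fin_cases m₀ <;> fin_cases m <;>
      simp only [Matrix.cons_val_zero, Matrix.cons_val_one, Matrix.cons_val, Fin.isValue, Fin.mk_one,
        Fin.zero_eta, Fin.reduceFinMk] at hcl ⊢ <;>
      first
        | (simp; done)
        | (rw [← dist_eq_norm]
           exact hcl _ (injective_site_mem s _)
             (injective_site_dist_le_one hs k _ _ _ _ _ _ (by norm_num) (by norm_num) (by push_cast; ring)))
        | (rw [← dist_eq_norm]; exact injective_far_CD hs hL k i j A l hl hcl)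
        | (rw [← dist_eq_norm]; exact injective_far_DC hs hL k i j A l hl hcl)

/-- CELL PACKAGE for the closed cell quarter `{C, D, E, A}` (`E = (1,0,1)`) of prism `(k, i, j)`: closed, convex,
hat functions `√2`-Lipschitz, star estimate `27/40 · l` from every vertex. -/
theorem injective_good_EA {s : ℤ → ℤ} (hs : IsHaggSeq s) (k i j : ℤ) :
    ∀ C : Set E3, C = {x : E3 | 0 ≤ toSkew s k x 1 - j ∧ toSkew s k x 0 - i ≤ 1 ∧ (toSkew s k x 1 - j) + toSkew s k x 2 ≤ 1 ∧
        1 ≤ (toSkew s k x 0 - i) + toSkew s k x 2} →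
      IsClosed C ∧ Convex ℝ C ∧
      (∀ t₀ : ℤ × ℤ × ℤ, ∀ z ∈ C, ∀ z' ∈ C,
        |plExtend s (fun t => if t = t₀ then (1 : ℝ) else 0) z -
          plExtend s (fun t => if t = t₀ then (1 : ℝ) else 0) z'| ≤ Real.sqrt 2 * ‖z - z'‖) ∧
      (∀ Ψ : E3 → E3, LocSim s Ψ → ∀ (t₀ : ℤ × ℤ × ℤ) (A : E3 →ₗᵢ[ℝ] E3) (l : ℝ), 0 < l →
        (∀ q ∈ idealStacking s, dist q (siteAt s t₀) ≤ 1 →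
          dist (Ψ q) (Ψ (siteAt s t₀) + l • A (q - siteAt s t₀)) ≤ 1 / 20 * l) →
        (∃ y ∈ C, plExtend s (fun t => if t = t₀ then (1 : ℝ) else 0) y ≠ 0) →
        ∀ z ∈ C, ∀ z' ∈ C, ‖plExtend s (fun t => Ψ (siteAt s t)) z -
          plExtend s (fun t => Ψ (siteAt s t)) z' - l • A (z - z')‖ ≤ 27 / 40 * l * ‖z - z'‖) := by
  rintro C rfl
  refine injective_good_of hs k i j (fun a b θ => 0 ≤ b ∧ a ≤ 1 ∧ b + θ ≤ 1 ∧ 1 ≤ a + θ)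
    ![fun _ b _ => b, fun a _ _ => 1 - a, fun a _ θ => a + θ - 1, fun _ b θ => 1 - b - θ]
    ![skewSite s k (i + 1) (j + 1) 0, skewSite s k i j 1, skewSite s k (i + 1) j 1, skewSite s k (i + 1) j 0]
    _ rfl (honeycomb_cellEA_continuousOn hs (fun _ => (0 : ℝ)) k i j).1 ?_ ?_ ?_ ?_ ?_ ?_
    ![![0, 61 / 190, 1 / 20, 1 / 20], ![61 / 190, 0, 1 / 20, 1 / 20], ![1 / 20, 1 / 20, 0, 1 / 20],
      ![1 / 20, 1 / 20, 1 / 20, 0]] ?_ ?_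
  · rintro a b θ a' b' θ' p q hp hq hpq ⟨h1, h2, h3, h4⟩ ⟨h1', h2', h3', h4'⟩
    refine ⟨?_, ?_, ?_, ?_⟩ <;> nlinarith [mul_nonneg hp (sub_nonneg.2 h1), mul_nonneg hq (sub_nonneg.2 h1'),
      mul_nonneg hp (sub_nonneg.2 h2), mul_nonneg hq (sub_nonneg.2 h2'), mul_nonneg hp (sub_nonneg.2 h3),
      mul_nonneg hq (sub_nonneg.2 h3'), mul_nonneg hp (sub_nonneg.2 h4), mul_nonneg hq (sub_nonneg.2 h4')]
  · rintro W _ _ g a b θ ⟨h1, h2, h3, h4⟩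
    rw [honeycomb_plExtend_cellEA hs g k i j a b θ h1 h2 h3 h4, Fin.sum_univ_four]
    simp
  · intro a b θ
    rw [Fin.sum_univ_four]
    simp only [Matrix.cons_val_zero, Matrix.cons_val_one, Matrix.cons_val]
    rw [honeycomb_siteAt_skewSite s k (i + 1) (j + 1) 0 (Or.inl rfl) hs,
      honeycomb_siteAt_skewSite s k i j 1 (Or.inr rfl) hs,
      honeycomb_siteAt_skewSite s k (i + 1) j 1 (Or.inr rfl) hs,
      honeycomb_siteAt_skewSite s k (i + 1) j 0 (Or.inl rfl) hs]
    simp only [ofSkew, Matrix.cons_val_zero, Matrix.cons_val_one, Matrix.cons_val]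
    push_cast
    module
  · intro a b θ
    simp only [Fin.sum_univ_four, Matrix.cons_val_zero, Matrix.cons_val_one, Matrix.cons_val]
    ring
  · intro m a b θ a' b' θ'
    obtain ⟨f1, f2, f3, f4, f5, f6, f7⟩ := injective_forms (a - a') (b - b') (θ - θ')
    rw [honeycomb_sqdist_ofSkew s k (hs k)]
    fin_cases m <;> simp <;> nlinarith [f1, f2, f3, f4, f5, f6, f7]
  · intro m m' h
    fin_cases m <;> fin_cases m' <;> simp [injective_skewSite_eq_iff (hs k)] at h ⊢
  · intro m₀
    fin_cases m₀ <;> simp [Fin.sum_univ_four] <;> norm_num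
  · intro Ψ hL m₀ A l hl hcl m
    fin_cases m₀ <;> fin_cases m <;>
      simp only [Matrix.cons_val_zero, Matrix.cons_val_one, Matrix.cons_val, Fin.isValue, Fin.mk_one,
        Fin.zero_eta, Fin.reduceFinMk] at hcl ⊢ <;>
      first
        | (simp; done)
        | (rw [← dist_eq_norm]
           exact hcl _ (injective_site_mem s _)
             (injective_site_dist_le_one hs k _ _ _ _ _ _ (by norm_num) (by norm_num) (by push_cast; ring)))
        | (rw [← dist_eq_norm]; exact injective_far_CD hs hL k i j A l hl hcl)
        | (rw [← dist_eq_norm]; exact injective_far_DC hs hL k i j A l hl hcl)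

/-- SUB-GOAL (registered anchor `injective_goodUp`): the star-estimate clause of the package of the
closed tetrahedron `T↑` of prism `(k, i, j)`. -/
theorem injective_goodUp : ∀ (s : ℤ → ℤ), IsHaggSeq s → ∀ (k i j : ℤ) (Ψ : E3 → E3), LocSim s Ψ → ∀ (t₀ : ℤ × ℤ × ℤ) (A : E3 →ₗᵢ[ℝ] E3) (l : ℝ), 0 < l → (∀ q ∈ idealStacking s, dist q (siteAt s t₀) ≤ 1 → dist (Ψ q) (Ψ (siteAt s t₀) + l • A (q - siteAt s t₀)) ≤ 1 / 20 * l) → (∃ y ∈ {x : E3 | 0 ≤ toSkew s k x 0 - i ∧ 0 ≤ toSkew s k x 1 - j ∧ 0 ≤ toSkew s k x 2 ∧ (toSkew s k x 0 - i) + (toSkew s k x 1 - j) + toSkew s k x 2 ≤ 1}, plExtend s (fun t => if t = t₀ then (1 : ℝ) else 0) y ≠ 0) → ∀ z ∈ {x : E3 | 0 ≤ toSkew s k x 0 - i ∧ 0 ≤ toSkew s k x 1 - j ∧ 0 ≤ toSkew s k x 2 ∧ (toSkew s k x 0 - i) + (toSkew s k x 1 - j) + toSkew s k x 2 ≤ 1},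 ∀ z' ∈ {x : E3 | 0 ≤ toSkew s k x 0 - i ∧ 0 ≤ toSkew s k x 1 - j ∧ 0 ≤ toSkew s k x 2 ∧ (toSkew s k x 0 - i) + (toSkew s k x 1 - j) + toSkew s k x 2 ≤ 1}, ‖plExtend s (fun t => Ψ (siteAt s t)) z - plExtend s (fun t => Ψ (siteAt s t)) z' - l • A (z - z')‖ ≤ 27 / 40 * l * ‖z - z'‖ :=
  fun _ hs k i j Ψ hL t₀ A l hl hcl hy z hz z' hz' =>
    (injective_good_up hs k i j _ rfl).2.2.2 Ψ hL t₀ A l hl hcl hy z hz z' hz'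

end Summit.AtomisticToContinuum.Crystallization.Theorems.HullExactificationCascadeRobustBarlowTemplate

end
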